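import Literature.Computability.AlgebraicComplexity.VBPClosedUnderComposition
import Literature.Computability.AlgebraicComplexity.FormulaUnfolding
import Literature.Computability.AlgebraicComplexity.BLMW11FormulasWeaklySkew
import Literature.Computability.AlgebraicComplexity.DDS21BorderDepthThree
import HarnessLib

/-!
# Univariate-label layered ABPs (DDS 2021, Def. 2.5) have polynomial weakly-skew complexity

Source currencies: Dutta–Dwivedi–Saxena, *Demystifying the border of depth-3 algebraic circuits*
(FOCS 2021 / full version), Def. 2.5 — algebraic branching programs with UNIVARIATE polynomial edge
labels of degree `≤ S`, the tree's `DDS2021.UABPComputes S f` (`DDS21BorderDepthThree.lean`, the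
currency in which the tree proves DDS21 Thm. 3.2, `DDS2021_thm_3_2_holds`); Bürgisser–Landsberg–
Manivel–Weyman 2011 §9.1 — weakly-skew complexity `L_ws` (the tree's `wsComplexity`, class `VP_ws`).

## What is proved

`UABPWs.vpwsOfUABP (F) : ∃ c, ∀ n S (f : MvPolynomial (Fin n) F), DDS2021.UABPComputes S f →
wsComplexity f ≤ (S + n + 2) ^ c` (with `c = 178`, crude), over every commutative ring, through the
tree's inverse read-outs (`HasInvRepr`, BCS Thm. (21.27)): `f = ((1 − N)⁻¹)_{s t}` for the layered
label matrix `N` (`LayeredABPComputes.inv_one_sub_apply`, `det (1 − N) = 1`); every entry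
`δ_{pq} − N_{pq}` is a univariate polynomial of degree `≤ S`, hence has formula size `O(S²)`
(`formulaComplexity_le_of_card_vars_le_one`) and an inverse read-out of size `O(S⁴)`
(`hasInvRepr_of_wsComplexity_le`); the substitution gadget `hasInvRepr_readOut` assembles ONE
read-out of size `V²·O(S⁴) + V`, and `wsComplexity_le_of_hasInvRepr` returns to weakly-skew circuits
(`wsComplexity_le_of_uabpComputes`, explicit bound `wsBound S n`; envelope `wsBound_le_pow`).
No named facts, no `sorry`; census +0.  Honest framing: bookkeeping between two renderings of
"algebraic branching program" (Malod–Portier 2008 Prop. 5: ABPs = weakly-skew circuits up to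
polynomial factors); nothing here bears on VP versus VNP.

References: [DuttaDwivediSaxena2022] Def. 2.5 and Thm. 3.2; [BurgisserClausenShokrollahi1997]
Thm. (21.27); [MalodPortier2008] Prop. 5; [BurgisserEtAl2011] §9.1.
-/

namespace Literature.Computability.AlgebraicComplexity

open MvPolynomial Finset
open _root_.Matrix

universe u v

namespace UABPWs

section Formula

variable {F : Type u} [CommSemiring F] {σ : Type v}

/-- `E(C c) = 0`. [cite: BurgisserClausenShokrollahi1997, (21.19)] -/
theorem formulaComplexity_C_le (c : F) : formulaComplexity (C c : MvPolynomial σ F) ≤ 0 :=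
  ((exists_wexpr_iff_formulaComplexity_le (C c : MvPolynomial σ F) 0).mp
    ⟨.const c, by simp, le_rfl⟩)

/-- `E(X i) = 0`. [cite: BurgisserClausenShokrollahi1997, (21.19)] -/
theorem formulaComplexity_X_le (i : σ) : formulaComplexity (X i : MvPolynomial σ F) ≤ 0 :=
  ((exists_wexpr_iff_formulaComplexity_le (X i : MvPolynomial σ F) 0).mp
    ⟨.var i, by simp, le_rfl⟩)

/-- `E(X i ^ e) ≤ e`. [folklore] -/
private theorem formulaComplexity_X_pow_le (i : σ) (e : ℕ) :
    formulaComplexity (X i ^ e : MvPolynomial σ F) ≤ e := by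
  induction e with
  | zero =>
    rw [pow_zero, ← C_1]
    exact (formulaComplexity_C_le (1 : F)).trans le_rfl
  | succ e ih =>
    rw [pow_succ]
    refine (formulaComplexity_mul_le _ _).trans ?_
    have := formulaComplexity_X_le (F := F) i
    omega

/-- Products over a finset: `E(∏ u_i) ≤ ∑ (E(u_i) + 1)`. [cite: BurgisserClausenShokrollahi1997, §21.1 p. 549] -/
theorem formulaComplexity_finset_prod_le {ι : Type*} (s : Finset ι) (u : ι → MvPolynomial σ F) :
    formulaComplexity (∏ i ∈ s, u i) ≤ ∑ i ∈ s, (formulaComplexity (u i) + 1) := by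
  classical
  induction s using Finset.induction_on with
  | empty =>
    rw [Finset.prod_empty, Finset.sum_empty, ← C_1]
    exact formulaComplexity_C_le (1 : F)
  | insert a s ha ih =>
    rw [Finset.prod_insert ha, Finset.sum_insert ha]
    refine (formulaComplexity_mul_le _ _).trans ?_
    omega

/-- Sums over a finset: `E(∑ u_i) ≤ ∑ (E(u_i) + 1)`. [cite: BurgisserClausenShokrollahi1997, §21.1 p. 549] -/
theorem formulaComplexity_finset_sum_le' {ι : Type*} (s : Finset ι) (u : ι → MvPolynomial σ F) :
    formulaComplexity (∑ i ∈ s, u i) ≤ ∑ i ∈ s, (formulaComplexity (u i) + 1) := by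
  classical
  induction s using Finset.induction_on with
  | empty =>
    rw [Finset.sum_empty, Finset.sum_empty, ← C_0]
    exact formulaComplexity_C_le (0 : F)
  | insert a s ha ih =>
    rw [Finset.sum_insert ha, Finset.sum_insert ha]
    refine (formulaComplexity_add_le _ _).trans ?_
    omega

/-- `E(monomial m c) ≤ 2 · deg m + 1`. [folklore] -/
private theorem formulaComplexity_monomial_le (m : σ →₀ ℕ) (c : F) :
    formulaComplexity (monomial m c : MvPolynomial σ F) ≤ 2 * (m.sum fun _ e => e) + 1 := by
  classical
  rw [monomial_eq]
  refine (formulaComplexity_mul_le _ _).trans ?_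
  have hC := formulaComplexity_C_le (σ := σ) c
  have hP : formulaComplexity (m.prod fun n e => (X n : MvPolynomial σ F) ^ e) ≤
      ∑ i ∈ m.support, (m i + 1) := by
    unfold Finsupp.prod
    refine (formulaComplexity_finset_prod_le _ _).trans (Finset.sum_le_sum fun i _ => ?_)
    exact Nat.add_le_add_right (formulaComplexity_X_pow_le i (m i)) 1
  have hcard : m.support.card ≤ m.sum fun _ e => e := by
    unfold Finsupp.sum
    rw [Finset.card_eq_sum_ones]
    exact Finset.sum_le_sum fun i hi => Nat.one_le_iff_ne_zero.2 (Finsupp.mem_support_iff.1 hi)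
  have hsum : ∑ i ∈ m.support, (m i + 1) = (m.sum fun _ e => e) + m.support.card := by
    unfold Finsupp.sum
    rw [Finset.sum_add_distrib, Finset.card_eq_sum_ones]
  omega

/-- In a polynomial involving at most one variable, distinct monomials have distinct degrees; with
total degree `≤ S` there are at most `S + 1` of them. [folklore] -/
private theorem card_support_le_of_card_vars_le_one (p : MvPolynomial σ F) (h1 : p.vars.card ≤ 1) {S : ℕ}
    (hS : p.totalDegree ≤ S) : p.support.card ≤ S + 1 := by
  classical
  have hdeg : ∀ m ∈ p.support, (m.sum fun _ e => e) ≤ S := fun m hm =>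
    (Finset.le_sup (f := fun s : σ →₀ ℕ => s.sum fun _ e => e) hm).trans hS
  have hsub : ∀ {μ : σ →₀ ℕ}, μ ∈ p.support → ∀ j ∈ μ.support, j ∈ p.vars :=
    fun hμ j hj => (mem_vars_iff_mem_support j).2 ⟨_, hμ, hj⟩
  have key : Set.InjOn (fun m : σ →₀ ℕ => m.sum fun _ e => e) ↑p.support := by
    intro m hm m' hm' he
    simp only [Finset.mem_coe] at hm hm'
    rcases Finset.eq_empty_or_nonempty p.vars with h0 | ⟨a, ha⟩
    · have hm0 : m = 0 := Finsupp.support_eq_empty.1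
        (Finset.eq_empty_of_forall_notMem fun j hj => by simpa [h0] using hsub hm j hj)
      have hm0' : m' = 0 := Finsupp.support_eq_empty.1
        (Finset.eq_empty_of_forall_notMem fun j hj => by simpa [h0] using hsub hm' j hj)
      rw [hm0, hm0']
    · have hall : ∀ b ∈ p.vars, b = a := fun b hb => Finset.card_le_one.1 h1 b hb a ha
      have hms : m.support ⊆ {a} := fun j hj => Finset.mem_singleton.2 (hall j (hsub hm j hj))
      have hms' : m'.support ⊆ {a} := fun j hj => Finset.mem_singleton.2 (hall j (hsub hm' j hj))
      rw [Finsupp.support_subset_singleton] at hms hms'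
      rw [hms, hms'] at he ⊢
      simp only [Finsupp.sum_single_index] at he
      rw [he]
  calc p.support.card ≤ (Finset.range (S + 1)).card :=
        Finset.card_le_card_of_injOn (fun m : σ →₀ ℕ => m.sum fun _ e => e)
          (fun m hm => Finset.mem_coe.2 (Finset.mem_range.2 (Nat.lt_succ_of_le
            (hdeg m (Finset.mem_coe.1 hm))))) key
    _ = S + 1 := Finset.card_range _

/-- **Univariate labels are cheap**: a polynomial with at most one variable and total degree `≤ S`
has formula size `≤ (S + 1)(2S + 2)`. [folklore] -/
private theorem formulaComplexity_le_of_card_vars_le_one (p : MvPolynomial σ F) (h1 : p.vars.card ≤ 1)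
    {S : ℕ} (hS : p.totalDegree ≤ S) : formulaComplexity p ≤ (S + 1) * (2 * S + 2) := by
  classical
  have hdeg : ∀ m ∈ p.support, (m.sum fun _ e => e) ≤ S := fun m hm =>
    (Finset.le_sup (f := fun s : σ →₀ ℕ => s.sum fun _ e => e) hm).trans hS
  calc formulaComplexity p
        = formulaComplexity (∑ m ∈ p.support, monomial m (coeff m p)) := by rw [← p.as_sum]
    _ ≤ ∑ m ∈ p.support, (formulaComplexity (monomial m (coeff m p)) + 1) :=
        formulaComplexity_finset_sum_le' _ _
    _ ≤ ∑ _m ∈ p.support, (2 * S + 2) := Finset.sum_le_sum fun m hm => by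
        have := formulaComplexity_monomial_le (F := F) m (coeff m p)
        have := hdeg m hm
        omega
    _ = p.support.card * (2 * S + 2) := by rw [Finset.sum_const, smul_eq_mul]
    _ ≤ (S + 1) * (2 * S + 2) :=
        Nat.mul_le_mul_right _ (card_support_le_of_card_vars_le_one p h1 hS)

end Formula

section Main

variable {F : Type u} [CommRing F]

/-- The entry size bound `b₀(S) = (S+1)(2S+2) + 2` for `δ_{pq} − N_{pq}`. [folklore] -/
def entryBound (S : ℕ) : ℕ := (S + 1) * (2 * S + 2) + 2

/-- The read-out size of one entry, `b(S) = (12 b₀ + 4)(24 b₀ + 4) + 2`. [folklore] -/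
def readOutBound (S : ℕ) : ℕ := (12 * entryBound S + 4) * (24 * entryBound S + 4) + 2

/-- The total inverse read-out size `m(S) = S² b(S) + S`. [folklore] -/
def invReprBound (S : ℕ) : ℕ := S * S * readOutBound S + S

/-- The weakly-skew bound `((m+3)(4(m+1)³+7)² + (m+1)²)(2n+3)`. [folklore] -/
def wsBound (S n : ℕ) : ℕ :=
  ((invReprBound S + 1 + 2) * (4 * (invReprBound S + 1) ^ 3 + 7) ^ 2 +
    (invReprBound S + 1) * (invReprBound S + 1)) * (2 * n + 3)

/-- Entries of `1 − N` for a univariate-labelled `N`: formula size `≤ b₀(S)`. [folklore] -/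
private theorem formulaComplexity_one_sub_apply_le {V n S : ℕ}
    (N : Matrix (Fin V) (Fin V) (MvPolynomial (Fin n) F))
    (hlab : ∀ u v, (N u v).vars.card ≤ 1 ∧ (N u v).totalDegree ≤ S) (p q : Fin V) :
    formulaComplexity ((1 - N) p q) ≤ entryBound S := by
  have hN := formulaComplexity_le_of_card_vars_le_one (N p q) (hlab p q).1 (hlab p q).2
  have hneg : formulaComplexity ((-1 : F) • N p q) ≤ (S + 1) * (2 * S + 2) + 1 :=
    (formulaComplexity_smul_le _ _).trans (by omega)
  rw [Matrix.sub_apply, Matrix.one_apply, sub_eq_add_neg, ← neg_one_smul F (N p q)]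
  refine (formulaComplexity_add_le _ _).trans ?_
  have h1 : formulaComplexity (if p = q then (1 : MvPolynomial (Fin n) F) else 0) ≤ 0 := by
    split_ifs
    · rw [← C_1]; exact formulaComplexity_C_le (1 : F)
    · rw [← C_0]; exact formulaComplexity_C_le (0 : F)
  unfold entryBound
  omega

/-- **A univariate-labelled layered ABP is an inverse read-out of size `m(S)`.**
[cite: BurgisserClausenShokrollahi1997, Thm. (21.27) (proof, property (C))] -/
theorem hasInvRepr_of_uabpComputes {n S : ℕ} {f : MvPolynomial (Fin n) F}
    (hf : DDS2021.UABPComputes S f) : HasInvRepr f (invReprBound S) := by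
  classical
  obtain ⟨V, hV, layer, s, t, N, hN, hlab, hf⟩ := hf
  have hD : ∀ p q, HasInvRepr ((1 - N) p q) (readOutBound S) := fun p q =>
    hasInvRepr_of_wsComplexity_le
      ((wsComplexity_le_formulaComplexity _).trans (formulaComplexity_one_sub_apply_le N hlab p q))
  have hdet : (1 - N).det = 1 := LayeredABPComputes.det_one_sub layer N hN
  have hread := hasInvRepr_readOut (1 - N) hdet hD (Pi.single s 1) (Pi.single t 1)
  have hv : (fun i => C (Pi.single (M := fun _ : Fin V => F) s 1 i)) =
      (Pi.single s 1 : Fin V → MvPolynomial (Fin n) F) := by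
    funext i
    by_cases hi : i = s
    · subst hi; simp
    · simp [Pi.single_eq_of_ne hi]
  have hw : (fun j => C (Pi.single (M := fun _ : Fin V => F) t 1 j)) =
      (Pi.single t 1 : Fin V → MvPolynomial (Fin n) F) := by
    funext j
    by_cases hj : j = t
    · subst hj; simp
    · simp [Pi.single_eq_of_ne hj]
  rw [hv, hw, Matrix.mulVec_single_one, single_one_dotProduct, Matrix.col_apply,
    LayeredABPComputes.inv_one_sub_apply layer N hN s t, hf, Fintype.card_fin] at hread
  refine hread.mono ?_
  unfold invReprBound
  gcongr

/-- **`VPwsOfUABP`, explicit form**: `L_ws(f) ≤ wsBound S n` for every `f` computed by a DDS ABP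
within budget `S`. [cite: DuttaDwivediSaxena2022, Def. 2.5] [cite: BurgisserEtAl2011, §9.1] -/
theorem wsComplexity_le_of_uabpComputes {n S : ℕ} {f : MvPolynomial (Fin n) F}
    (hf : DDS2021.UABPComputes S f) : wsComplexity f ≤ wsBound S n := by
  have h := wsComplexity_le_of_hasInvRepr (hasInvRepr_of_uabpComputes hf)
  simpa only [wsBound, Fintype.card_fin] using h

end Main

/-! ## The polynomial envelope `(S + n + 2) ^ 178` -/

section Envelope

/-- Envelope arithmetic: products of powers of the base. [folklore] -/
private theorem mul_le_pow {X a b i j : ℕ} (ha : a ≤ X ^ i) (hb : b ≤ X ^ j) :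
    a * b ≤ X ^ (i + j) := by
  rw [pow_add]; exact Nat.mul_le_mul ha hb

/-- Envelope arithmetic: a sum of two terms below `X^i` is below `X^(i+1)` once `2 ≤ X`. [folklore] -/
private theorem add_le_pow {X a b i : ℕ} (hX : 2 ≤ X) (ha : a ≤ X ^ i) (hb : b ≤ X ^ i) :
    a + b ≤ X ^ (i + 1) := by
  rw [pow_succ]
  calc a + b ≤ X ^ i * 2 := by omega
    _ ≤ X ^ i * X := Nat.mul_le_mul_left _ hX

/-- Envelope arithmetic: constants below `2^i` are below `X^i` once `2 ≤ X`. [folklore] -/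
private theorem const_le_pow {X k i : ℕ} (hX : 2 ≤ X) (hk : k ≤ 2 ^ i) : k ≤ X ^ i :=
  hk.trans (Nat.pow_le_pow_left hX i)

/-- Envelope arithmetic: monotonicity of `X^·` in the exponent (`2 ≤ X`). [folklore] -/
private theorem weaken {X a i j : ℕ} (hX : 2 ≤ X) (ha : a ≤ X ^ i) (hij : i ≤ j) : a ≤ X ^ j :=
  ha.trans (Nat.pow_le_pow_right (by omega) hij)

/-- Envelope arithmetic: rewrite the exponent along a numeral identity. [folklore] -/
private theorem recast {X a i k : ℕ} (ha : a ≤ X ^ i) (hk : i = k) : a ≤ X ^ k := hk ▸ ha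

/-- Envelope arithmetic: powers of a bound. [folklore] -/
private theorem pow_le_powpow {X a i : ℕ} (ha : a ≤ X ^ i) (e : ℕ) : a ^ e ≤ X ^ (i * e) := by
  rw [pow_mul]; exact Nat.pow_le_pow_left ha e

/-- `wsBound S n ≤ (S + n + 2) ^ 178` (crude). [folklore] -/
private theorem wsBound_le_pow (S n : ℕ) : wsBound S n ≤ (S + n + 2) ^ 178 := by
  have hX : 2 ≤ S + n + 2 := by omega
  have hS1 : S + 1 ≤ (S + n + 2) ^ 1 := by rw [pow_one]; omega
  have hS : S ≤ (S + n + 2) ^ 1 := by rw [pow_one]; omega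
  have hn1 : n ≤ (S + n + 2) ^ 1 := by rw [pow_one]; omega
  generalize S + n + 2 = X at hX hS1 hS hn1 ⊢
  have c1 : 1 ≤ X ^ 0 := const_le_pow hX (by norm_num)
  have c2 : 2 ≤ X ^ 1 := const_le_pow hX (by norm_num)
  have c3 : 3 ≤ X ^ 2 := const_le_pow hX (by norm_num)
  have c4 : 4 ≤ X ^ 2 := const_le_pow hX (by norm_num)
  have c7 : 7 ≤ X ^ 3 := const_le_pow hX (by norm_num)
  have c12 : 12 ≤ X ^ 4 := const_le_pow hX (by norm_num)
  have c24 : 24 ≤ X ^ 5 := const_le_pow hX (by norm_num)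
  have h2S : 2 * S + 2 ≤ X ^ 2 := by
    have : 2 * S + 2 = 2 * (S + 1) := by ring
    rw [this]
    exact recast (mul_le_pow c2 hS1) (by norm_num)
  -- b₀ ≤ X^4
  have hb0 : entryBound S ≤ X ^ 4 := by
    unfold entryBound
    exact recast (add_le_pow hX (mul_le_pow hS1 h2S) (weaken hX c2 (by norm_num))) (by norm_num)
  -- b ≤ X^20
  have hb : readOutBound S ≤ X ^ 20 := by
    unfold readOutBound
    have h12 : 12 * entryBound S + 4 ≤ X ^ 9 :=
      recast (add_le_pow hX (mul_le_pow c12 hb0) (weaken hX c4 (by norm_num))) (by norm_num)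
    have h24 : 24 * entryBound S + 4 ≤ X ^ 10 :=
      recast (add_le_pow hX (mul_le_pow c24 hb0) (weaken hX c4 (by norm_num))) (by norm_num)
    exact recast (add_le_pow hX (mul_le_pow h12 h24) (weaken hX c2 (by norm_num))) (by norm_num)
  -- m ≤ X^23
  have hm : invReprBound S ≤ X ^ 23 := by
    unfold invReprBound
    exact recast (add_le_pow hX (mul_le_pow (mul_le_pow hS hS) hb) (weaken hX hS (by norm_num)))
      (by norm_num)
  have hm1 : invReprBound S + 1 ≤ X ^ 24 :=
    recast (add_le_pow hX hm (weaken hX c1 (by norm_num))) (by norm_num)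
  have hm3 : invReprBound S + 1 + 2 ≤ X ^ 24 := by
    rw [add_assoc]
    exact recast (add_le_pow hX hm (weaken hX c3 (by norm_num))) (by norm_num)
  have hcube : 4 * (invReprBound S + 1) ^ 3 + 7 ≤ X ^ 75 :=
    recast (add_le_pow hX (mul_le_pow c4 (pow_le_powpow hm1 3)) (weaken hX c7 (by norm_num)))
      (by norm_num)
  have hsum : (invReprBound S + 1 + 2) * (4 * (invReprBound S + 1) ^ 3 + 7) ^ 2 +
      (invReprBound S + 1) * (invReprBound S + 1) ≤ X ^ 175 :=
    recast (add_le_pow hX (mul_le_pow hm3 (pow_le_powpow hcube 2))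
      (weaken hX (mul_le_pow hm1 hm1) (by norm_num))) (by norm_num)
  have hn : 2 * n + 3 ≤ X ^ 3 :=
    recast (add_le_pow hX (mul_le_pow c2 hn1) (weaken hX c3 (by norm_num))) (by norm_num)
  unfold wsBound
  exact recast (mul_le_pow hsum hn) (by norm_num)

/-- **`VPwsOfUABP` in the lens-3 node's typed form** (verbatim the v3.1 signature, generalised from
`ℂ` to every commutative ring): `∃ c, ∀ n S f, UABPComputes S f → L_ws(f) ≤ (S + n + 2) ^ c`.
[cite: DuttaDwivediSaxena2022, Def. 2.5] [cite: BurgisserEtAl2011, §9.1] -/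
theorem vpwsOfUABP (F : Type u) [CommRing F] :
    ∃ c : ℕ, ∀ (n S : ℕ) (f : MvPolynomial (Fin n) F),
      DDS2021.UABPComputes S f → wsComplexity f ≤ (S + n + 2) ^ c :=
  ⟨178, fun n S _ hf => (wsComplexity_le_of_uabpComputes hf).trans (wsBound_le_pow S n)⟩

end Envelope

end UABPWs

end Literature.Computability.AlgebraicComplexity
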